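import Literature.MathematicalPhysics.QuantumManyBody.NeumannBoseGasCondensationProofs
import HarnessLib

/-!
# Junge 2026, Thm. 4 at `T = 0` (pinned Neumann lower bound): decomposition along the printed proof

Fact-decomposition file (librarian, mode `fact-decompose`, 2026-08-16) for the named fact
`Literature.MathematicalPhysics.QuantumManyBody.BoseGas.Junge2026_neumannBox_pinnedLowerBound`
(`NeumannBoseGasCondensation.lean`; L. Junge, arXiv:2603.20776, Thm. 4 at `T = 0`, the pinned form
of Fournais–Junge–Girardot–Morin–Olivieri–Triay, arXiv:2408.14222 = Ann. Henri Poincaré (2026),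
Thm. 1.3).

The printed proof of [FournaisEtAl2024, Thm. 1.3] begins (§4, Lemma 4.1 and (4.1)–(4.3)) by
disposing of the states of energy above `4πρaN(1 + C₁(ρa³)^{1/17})` with the first-order bound of
Lieb–Seiringer–Solovej–Yngvason, and carries out the second-order (Lee–Huang–Yang) analysis of
§§2–6 only for the remaining LOW-ENERGY states, to which the a priori condensation estimate
Lemma 4.1 applies. The first-order rung and this reduction are PROVED in the tree
(`neumannBox_pinnedLowerBound_firstOrder`, `Junge2026_neumannBox_pinnedLowerBound.of_lowEnergy`,
`NeumannBoseGasCondensationProofs.lean`). What remains is therefore exactly ONE printed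
intermediate result, vended here as the child

* `Junge2026_neumannBox_pinnedLowerBound_lowEnergy` — the pinned second-order lower bound for
  Bose-symmetric Neumann states of energy `≤ 4πρaN(1 + C₁(ρa³)^{1/17})` on Junge's boxes
  `L = a(ρa³)^{-1/2-η}`, for every threshold `C₁ ≥ 0` and all `0 < η ≤ η₀(v, C₁)`
  ([FournaisEtAl2024, Thm. 1.3 restricted to the states of (4.3), i.e. §§2–6: replacement by an
  integrable potential, renormalised potential splitting, spectral gaps of the Neumann Laplacian,
  `3Q` localisation, symmetrisation and Bogoliubov diagonalisation; many of whose one-body and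
  lattice-sum ingredients are already proved in this directory: `LHY*.lean`,
  `NeumannSymmetrization*.lean`, `ScatteringLength*.lean`, `BogoliubovOneModeDiagonalization.lean`),

and `Junge2026_neumannBox_pinnedLowerBound_holds_of` PROVES the parent from it (by
`…of_lowEnergy`). The child does not restate the parent: it concerns a smaller class of states and
has a different quantifier structure (`∀ C₁ ∃ η₀ ∀ η ≤ η₀`), being false-proof against the
high-energy states the parent also covers.

## References

* [Junge2026] L. Junge, arXiv:2603.20776, Thm. 4, Rem. 5.
* [FournaisEtAl2024] S. Fournais, L. Junge, T. Girardot, L. Morin, M. Olivieri, A. Triay,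
  arXiv:2408.14222, Ann. Henri Poincaré (2026): Thm. 1.3, §4 Lemma 4.1 with (4.1)–(4.3), §§2–6.
* [LSSY2005] E. H. Lieb, R. Seiringer, J. P. Solovej, J. Yngvason, *The Mathematics of the Bose
  Gas and its Condensation* (2005), Thm. 5.1.
-/

noncomputable section

open scoped ENNReal NNReal
open MeasureTheory

namespace Literature.MathematicalPhysics.QuantumManyBody.BoseGas

/-- **[FournaisEtAl2024, Thm. 1.3] for low-energy states, pinned form (child of
`Junge2026_neumannBox_pinnedLowerBound`).** For a repulsive finite-range radially non-increasing
pair profile `v` with scattering length `0 < a < ∞` and every threshold `C₁ ≥ 0` there is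
`η₀ > 0` such that for all `0 < η ≤ η₀` there are `C, c > 0` with: for `N ≥ 1`, `L > 0`,
`ρ = N/L³`, `ρa³ ≤ c`, `L = a(ρa³)^{-1/2-η}`, every normalised Bose-symmetric Neumann state `Ψ`
on `Λ_L^N` of energy `⟨Ψ, H_N Ψ⟩ ≤ 4πρaN(1 + C₁(ρa³)^{1/17})` (the states left after
[FournaisEtAl2024, (4.1)–(4.3)], to which the a priori condensation Lemma 4.1 applies) satisfies
`4πρaN(1 + (128/(15√π))√(ρa³) - C(ρa³)^{1/2+η}) + (η/L²)N ≤ ⟨Ψ, H_N Ψ⟩ + (η/L²)⟨Ψ, n₀Ψ⟩`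
(additive `ℝ≥0∞` form of `⟨Ψ,(H_N - η n₊/L²)Ψ⟩ ≥ 4πρaN(1 + LHY - C(ρa³)^{1/2+η})`). This is the
content of §§2–6 of the source (the second-order analysis); [Junge2026, Rem. 5]: `η ≤ 1/32` at
`T = 0`. Verbatim the hypothesis of `Junge2026_neumannBox_pinnedLowerBound.of_lowEnergy`.
[cite: FournaisEtAl2024, Thm. 1.3 with §4 Lemma 4.1, (4.3), and §§2–6] [cite: Junge2026, Thm. 4, Rem. 5] -/
def Junge2026_neumannBox_pinnedLowerBound_lowEnergy : Prop :=
  ∀ (v : ℝ → ℝ≥0∞), IsRepulsiveFiniteRange v → AntitoneOn v (Set.Ici 0) →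
    scatteringLength v ≠ ⊤ → 0 < scatteringLength v →
    ∀ C₁ : ℝ, 0 ≤ C₁ →
    ∃ η₀ : ℝ, 0 < η₀ ∧ ∀ η : ℝ, 0 < η → η ≤ η₀ →
    ∃ C c : ℝ, 0 < C ∧ 0 < c ∧
      ∀ (N : ℕ) (L : ℝ), 0 < N → 0 < L →
        let a := (scatteringLength v).toReal
        let ρ := (N : ℝ) / L ^ 3
        ρ * a ^ 3 ≤ c →
        L = a * (ρ * a ^ 3) ^ (-(1 / 2 + η)) →
        ∀ Ψ : NeumannTrialState N L,
          (∀ (σ : Equiv.Perm (Fin N)) (X : Config N), Ψ.ψ (X ∘ σ) = Ψ.ψ X) →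
          neumannEnergy v Ψ ≤ ENNReal.ofReal (4 * Real.pi * ρ * a * N *
              (1 + C₁ * (ρ * a ^ 3) ^ ((1 : ℝ) / 17))) →
          ENNReal.ofReal (4 * Real.pi * ρ * a * N *
                (1 + 128 / (15 * Real.sqrt Real.pi) * Real.sqrt (ρ * a ^ 3)
                  - C * (ρ * a ^ 3) ^ (1 / 2 + η)))
              + ENNReal.ofReal (η / L ^ 2) * (N : ℝ≥0∞)
            ≤ neumannEnergy v Ψ + ENNReal.ofReal (η / L ^ 2) * condensateOccupation N L Ψ.ψ

/-- **Assembly (PROVED): Junge's Thm. 4 at `T = 0` from its low-energy half**, by the first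
reduction of the printed proof (`Junge2026_neumannBox_pinnedLowerBound.of_lowEnergy`: the
high-energy states are settled by the first-order pinned bound
`neumannBox_pinnedLowerBound_firstOrder`, [FournaisEtAl2024, (4.1)–(4.3)]).
[cite: FournaisEtAl2024, §4 Lemma 4.1 and (4.1)–(4.3)] -/
theorem Junge2026_neumannBox_pinnedLowerBound_holds_of
    (h : Junge2026_neumannBox_pinnedLowerBound_lowEnergy) :
    Junge2026_neumannBox_pinnedLowerBound :=
  Junge2026_neumannBox_pinnedLowerBound.of_lowEnergy h

end Literature.MathematicalPhysics.QuantumManyBody.BoseGas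

end
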